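import Summits.QuantumFields.BalabanUV.T4Continuum.Support.NE7QbarCurvedBaseLetter
import Summits.QuantumFields.BalabanUV.T4Continuum.Support.NE3QbarIterNearFlat
import HarnessLib

/-!
# NE7QbarCurvedBaseRadii — THE RELATIVE LINK RADII OF THE AVERAGED PAIR ALONG THE TOWER: `‖(cavg W)⁻¹(cavg U) − 1‖ ≤ L·r + κ₁·x` for two
# small-field backgrounds at relative link radius `r` (`κ₁ = 2L·n_b + 128(d+1)(d+4)L²` at a common plaquette radius `x`), hence along the class
# `‖(cavgIter i W)⁻¹(cavgIter i U) − 1‖ ≤ ρ_i` for every majorant `ρ_{i+1} ≥ L·ρ_i + κ₁·x_i`, e.g. `ρ_i = L^i·r₀ + (2κ₁∕L²)·x_i` — the input `r_i` of F68's tower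
# letter; letter (L4) ROAD B of the curved (APE) programme, file 3

Cell `pub-balaban`, rung (B)+1 sub-cell t4, lineage `b2b-balaban-t4-ne7-p1` (CRUX PROVER NE7 #1 = OWNER of row NE7), generation 76; memo
`t4/b2b-balaban-t4-ne7-p1-g75/CURVED-APE-ROAD.md` §2 (L4) ROAD B.  File F69 (over F67 `NE7QbarCurvedBaseLetter` (§1 gauge bookkeeping: `gaugeAct_eq_mul_conj`,
`norm_gaugeAct_sub_one_le_add`), row NE3's `NE3NestedBlockMeanCovariance.cavg_gaugeAct` (the average dresses covariantly), W4b `NE3QbarIterNearFlat.norm_cavg_sub_one_le_ball`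
(near-identity of the average from BALL-LOCAL link radii), lit-balaban's `B7Prop1Explicit.axialFn` ∕ `axial_bond_bound`, `AveragingDeficitTwoLevelPrep.cavg_isUnitaryCfg`,
`NE3TangentCovariantTower.step_small`, `NE3CovariantLineSumsError.sq_mul_le_prop1Radius`).
WHY (memo §2 (L4)).  F68 `NE7QbarCurvedBaseTower.sum_norm_QbarIter_sub_QbarIter_le_Kmaj` bounds the `ℓ¹` base-Lipschitz constant of the straight tower by
`K_maj·(L∕L^d)^j·Σ_{i≤j} λ(r_i, x_i)` given the RELATIVE LINK RADII `r_i` of the averaged pairs `(cavgIter i U, cavgIter i W)`.  THIS FILE supplies them from the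
bottom radius `r₀ = ‖W⁻¹U − 1‖_∞` (for the representative `U = W e^{Z}`: `r₀ ≤ e^{α₀} − 1`) and the plaquette radii of the class ALONE: per coarse bond, in the local
axial gauge of `W` rooted at `L•y`, both averages are within `L·δ + 4·loopRad` of the identity (W4b), `δ_W = n_b·x`, `δ_U = n_b·x + r`, and the relative variable
`(cavg W)⁻¹(cavg U)` CONJUGATES under the gauge (its radius is gauge invariant) — so `r₁ ≤ L·r + κ₁·x`; inner-first induction carries any recursive majorant
through the tower.  CURRENCY: `ρ_i = L^i r₀ + (2κ₁∕L²)x_i`, `x_i ≤ (17∕16)L^{2i}x` (`NE3TopRadiusLetters`), so `Σ_{i≤j} ρ_i ≤ 2L^j r₀ + (17κ₁∕4L²)·L^{2j}x = O(α̂ + b)∕L`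
in the letters `r₀ = α̂∕M`, `x = b∕M²`, `M = L^{j+1}` — level-uniform, as the memo's currency line requires.
WHAT ([folklore]; 0 def, 0 sorry).
§1 **`norm_relLink_cavg_le`** (one step): `‖(cavg W)(y,μ)⁻¹(cavg U)(y,μ) − 1‖ ≤ L·r + 2L·n_b·a_W + 4(loopRad a_U + loopRad a_W)`.
§2 **`norm_relLink_cavgIter_le`** (the tower of radii): in the `(j)`-level class at a common radius `x`, for every `ρ : ℕ → ℝ` with `‖W⁻¹U − 1‖ ≤ ρ 0` and
   `L·ρ_i + κ₁·x_i ≤ ρ_{i+1}` (`i < j`), `‖(cavgIter i W)⁻¹(cavgIter i U) − 1‖ ≤ ρ_i` for all `i ≤ j`.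
§3 `majorant_step` — the explicit majorant `ρ_i = L^i r₀ + (2κ₁∕L²)·x_i` satisfies the recursion for `L ≥ 2`; **`norm_relLink_cavgIter_le_explicit`**.
HONEST FRAMING (page 1): lattice kinematics of the averaging tower (near-identity letters in a local axial gauge); the TT assembly and (APE) are NOT here; nothing of
Bałaban's asserted; NOT ONE-STEP, NOT NE7; spine 0∕9; finite T⁴ rung (B)+1 — NOT infinite volume, NOT mass gap, NOT `BetaPertH`, NOT Clay.  Continuum YM on
T⁴ ⇐ BetaPertH ∧ nine spine estimates (0/9 proved); BetaPertH ⇐ (D1) ∧ (D4) ∧ CAP+tail; G-an2-4 gates asym, D1 and NE2/3/4.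
-/

set_option autoImplicit false

open scoped BigOperators Matrix.Norms.L2Operator
open Finset

namespace Summit.QuantumFields.BalabanUV.T4Continuum.NE7QbarCurvedBaseRadii

open Literature.MathematicalPhysics.QuantumFieldTheory.Balaban1983to89
open B7Prop1Explicit B7Prop2Explicit
open T4AveragingDeficitWall (IsUnitaryCfg SmallField Ad)
open AveragingDeficitTransport (norm_Ad_of_unitary mem_U1_of_unitary)
open AveragingDeficitChartCalculus (cavg)
open AveragingDeficitTwoLevelPrep (prop1Radius twoLevelSmall cavg_isUnitaryCfg)
open AveragingDeficitMultiLevelPrep (cavgIter LevelSmall prop1Radius_nonneg)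
open SpreadLift (loopRad)
open BlockAverageVaryHolo (nbRad l1_sub_self)
open NE3TangentCovariantTower (cavgIter_succ step_small)
open NE3NestedBlockMeanCovariance (cavg_gaugeAct)
open NE3QbarIterNearFlat (norm_cavg_sub_one_le_ball)
open NE3CovariantLineSumsError (sq_mul_le_prop1Radius iterate_prop1Radius_nonneg)
open NE7QbarCurvedBaseLetter (norm_gaugeAct_sub_one_le_add)

noncomputable section

variable {d : ℕ} {n : Type*} [Fintype n] [DecidableEq n]

/-! ## §1 One step: the relative radius of the averaged pair -/

/-- **THE RELATIVE LINK RADIUS OF THE AVERAGED PAIR** (one step).  `U`, `W` unitary, `SmallField U a_U`, `SmallField W a_W` (`512(d+1)(d+4)L²a ≤ 1` each),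
`‖W(x,μ)⁻¹U(x,μ) − 1‖ ≤ r` everywhere.  Then for every coarse bond `(y,μ)`,
`‖(cavg L W y μ)⁻¹·(cavg L U y μ) − 1‖ ≤ L·r + 2L·(n_b·a_W) + 4·(loopRad a_U + loopRad a_W)` (both averages read in the axial gauge of `W` rooted at `L•y`, where
they are within `L·δ + 4·loopRad` of the identity by W4b; the relative variable conjugates). [folklore] -/
theorem norm_relLink_cavg_le [Nonempty n] {L : ℕ} (hL : 1 ≤ L) {U W : Site d → Fin d → (Matrix n n ℂ)ˣ} (hUu : IsUnitaryCfg U) (hWu : IsUnitaryCfg W)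
    {aU aW : ℝ} (haU : 0 ≤ aU) (haW : 0 ≤ aW) (h512U : 512 * (d + 1) * (d + 4) * (L : ℝ) ^ 2 * aU ≤ 1) (h512W : 512 * (d + 1) * (d + 4) * (L : ℝ) ^ 2 * aW ≤ 1)
    (hUa : SmallField U aU) (hWa : SmallField W aW)
    {r : ℝ} (hr : ∀ (x : Site d) (μ : Fin d), ‖(((W x μ)⁻¹ * U x μ : (Matrix n n ℂ)ˣ) : Matrix n n ℂ) - 1‖ ≤ r) (y : Site d) (μ : Fin d) :
    ‖(((cavg L W y μ)⁻¹ * cavg L U y μ : (Matrix n n ℂ)ˣ) : Matrix n n ℂ) - 1‖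
      ≤ (L : ℝ) * r + 2 * L * ((nbRad d L : ℝ) * aW) + 4 * (loopRad d L aU + loopRad d L aW) := by
  set q : Site d := (L : ℤ) • y with hq
  set g : Site d → (Matrix n n ℂ)ˣ := axialFn W q with hg
  have hgu : ∀ x, g x ∈ unitaryUnits (Matrix n n ℂ) := fun x => hol_mem_of (S := unitaryUnits (Matrix n n ℂ)) hWu _ _
  have hgU : ∀ x, g x ∈ U1 (Matrix n n ℂ) := fun x => mem_U1_of_unitary (hgu x)
  have hWU1 : ∀ x ν, W x ν ∈ U1 (Matrix n n ℂ) := fun x ν => mem_U1_of_unitary (hWu x ν)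
  set Ug : Site d → Fin d → (Matrix n n ℂ)ˣ := gaugeAct g U with hUg
  set Wg : Site d → Fin d → (Matrix n n ℂ)ˣ := gaugeAct g W with hWg
  have hunit : ∀ {V : Site d → Fin d → (Matrix n n ℂ)ˣ}, IsUnitaryCfg V → IsUnitaryCfg (gaugeAct g V) := fun hV x ν =>
    (unitaryUnits _).mul_mem ((unitaryUnits _).mul_mem (hgu x) (hV x ν)) ((unitaryUnits _).inv_mem (hgu _))
  have hsmall : ∀ {V : Site d → Fin d → (Matrix n n ℂ)ˣ} {a : ℝ}, SmallField V a → SmallField (gaugeAct g V) a := by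
    intro V a hV x ν ν' hne
    rw [hol_gaugeAct_closed _ _ _ _ (disp_plaqWord _ _), Units.val_mul, Units.val_mul]
    exact (norm_units_conj_sub_one_le (hgU x) _).trans (hV x ν ν' hne)
  -- links on the stencil ball
  have hWlink : ∀ (x' : Site d) (ν : Fin d), l1 (x' - (L : ℤ) • y) ≤ nbRad d L + L * 0 →
      ‖((Wg x' ν : (Matrix n n ℂ)ˣ) : Matrix n n ℂ) - 1‖ ≤ (nbRad d L : ℝ) * aW := by
    intro x' ν hx'
    rw [Nat.mul_zero, Nat.add_zero] at hx'
    have h := axial_bond_bound W hWU1 q hWa haW x' ν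
    rw [← hg, ← hWg] at h
    exact h.trans (mul_le_mul_of_nonneg_right (by exact_mod_cast hx') haW)
  have hUlink : ∀ (x' : Site d) (ν : Fin d), l1 (x' - (L : ℤ) • y) ≤ nbRad d L + L * 0 →
      ‖((Ug x' ν : (Matrix n n ℂ)ˣ) : Matrix n n ℂ) - 1‖ ≤ (nbRad d L : ℝ) * aW + r := fun x' ν hx' =>
    (norm_gaugeAct_sub_one_le_add hgu hWu x' ν).trans (add_le_add (hWlink x' ν hx') (hr x' ν))
  -- the dressed averages are near the identity (W4b on the ball of radius `nbRad` about `L•y`)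
  have hy0 : l1 (y - y) ≤ 0 := by rw [l1_sub_self]
  have hAW := norm_cavg_sub_one_le_ball hL (hunit hWu) haW h512W (hsmall hWa) (R := 0) (b := y) hWlink y μ hy0
  have hAU := norm_cavg_sub_one_le_ball hL (hunit hUu) haU h512U (hsmall hUa) (R := 0) (b := y) hUlink y μ hy0
  -- the dressed averages
  have hcW : cavg L Wg = gaugeAct (fun w => g ((L : ℤ) • w)) (cavg L W) := by rw [hWg]; exact cavg_gaugeAct hL hWu haW h512W hWa hgu
  have hcU : cavg L Ug = gaugeAct (fun w => g ((L : ℤ) • w)) (cavg L U) := by rw [hUg]; exact cavg_gaugeAct hL hUu haU h512U hUa hgu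
  set A : (Matrix n n ℂ)ˣ := cavg L Wg y μ with hA
  set B : (Matrix n n ℂ)ˣ := cavg L Ug y μ with hB
  set X : (Matrix n n ℂ)ˣ := (cavg L W y μ)⁻¹ * cavg L U y μ with hX
  set h : (Matrix n n ℂ)ˣ := g ((L : ℤ) • (y + e μ)) with hh
  have hconj : A⁻¹ * B = h * X * h⁻¹ := by
    rw [hA, hB, hX, hh, hcW, hcU]
    unfold gaugeAct
    group
  have hXeq : X = h⁻¹ * (A⁻¹ * B) * h := by rw [hconj]; group
  have hAu : A ∈ U1 (Matrix n n ℂ) := by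
    rw [hA]; exact mem_U1_of_unitary (cavg_isUnitaryCfg hL (hunit hWu) haW h512W (hsmall hWa) y μ)
  -- `‖A⁻¹B − 1‖ ≤ ‖B − A‖ ≤ ‖B − 1‖ + ‖A − 1‖`
  have hAB : ‖((A⁻¹ * B : (Matrix n n ℂ)ˣ) : Matrix n n ℂ) - 1‖ ≤ ‖(B : Matrix n n ℂ) - 1‖ + ‖(A : Matrix n n ℂ) - 1‖ := by
    have e : ((A⁻¹ * B : (Matrix n n ℂ)ˣ) : Matrix n n ℂ) - 1 = ((A⁻¹ : (Matrix n n ℂ)ˣ) : Matrix n n ℂ) * (((B : Matrix n n ℂ) - 1) - ((A : Matrix n n ℂ) - 1)) := by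
      rw [Units.val_mul, sub_sub_sub_cancel_right, mul_sub, Units.inv_mul]
    rw [e]
    calc _ ≤ ‖((A⁻¹ : (Matrix n n ℂ)ˣ) : Matrix n n ℂ)‖ * ‖((B : Matrix n n ℂ) - 1) - ((A : Matrix n n ℂ) - 1)‖ := norm_mul_le _ _
      _ ≤ 1 * ‖((B : Matrix n n ℂ) - 1) - ((A : Matrix n n ℂ) - 1)‖ := mul_le_mul_of_nonneg_right (mem_U1.mp hAu).2 (norm_nonneg _)
      _ ≤ _ := by rw [one_mul]; exact norm_sub_le _ _
  calc ‖(X : Matrix n n ℂ) - 1‖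
      = ‖((h⁻¹ : (Matrix n n ℂ)ˣ) : Matrix n n ℂ) * ((A⁻¹ * B : (Matrix n n ℂ)ˣ) : Matrix n n ℂ) * (h : Matrix n n ℂ) - 1‖ := by
        rw [hXeq, Units.val_mul, Units.val_mul]
    _ ≤ ‖((A⁻¹ * B : (Matrix n n ℂ)ˣ) : Matrix n n ℂ) - 1‖ := norm_units_inv_conj_sub_one_le (hgU _) _
    _ ≤ ‖(B : Matrix n n ℂ) - 1‖ + ‖(A : Matrix n n ℂ) - 1‖ := hAB
    _ ≤ ((L : ℝ) * ((nbRad d L : ℝ) * aW + r) + 4 * loopRad d L aU) + ((L : ℝ) * ((nbRad d L : ℝ) * aW) + 4 * loopRad d L aW) :=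
        add_le_add hAU hAW
    _ = _ := by ring

/-! ## §2 The tower of relative radii -/

/-- **THE RELATIVE LINK RADII ALONG THE TOWER.**  `U`, `W` unitary with `SmallField · x`, `LevelSmall d L j x`; `ρ : ℕ → ℝ` with `‖W⁻¹U − 1‖ ≤ ρ 0` everywhere and
`L·ρ_i + (2L·n_b + 128(d+1)(d+4)L²)·x_i ≤ ρ_{i+1}` for `i < j` (`x_i = prop1Radius^[i] x`).  Then `‖(cavgIter L i W y μ)⁻¹·(cavgIter L i U y μ) − 1‖ ≤ ρ i` for all
`i ≤ j` and all bonds — inner-first induction over §1 (`4·(loopRad x + loopRad x) = 128(d+1)(d+4)L²·x`). [folklore] -/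
theorem norm_relLink_cavgIter_le [Nonempty n] {L : ℕ} (hL : 1 ≤ L) (j : ℕ) :
    ∀ {U W : Site d → Fin d → (Matrix n n ℂ)ˣ} {x : ℝ}, IsUnitaryCfg U → IsUnitaryCfg W → 0 ≤ x → LevelSmall d L j x → SmallField U x → SmallField W x →
    ∀ {ρ : ℕ → ℝ}, (∀ (y : Site d) (μ : Fin d), ‖(((W y μ)⁻¹ * U y μ : (Matrix n n ℂ)ˣ) : Matrix n n ℂ) - 1‖ ≤ ρ 0) →
      (∀ i, i < j → (L : ℝ) * ρ i + (2 * L * (nbRad d L : ℝ) + 128 * ((d : ℝ) + 1) * ((d : ℝ) + 4) * (L : ℝ) ^ 2) * (prop1Radius d L)^[i] x ≤ ρ (i + 1)) →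
    ∀ i, i ≤ j → ∀ (y : Site d) (μ : Fin d),
      ‖(((cavgIter L i W y μ)⁻¹ * cavgIter L i U y μ : (Matrix n n ℂ)ˣ) : Matrix n n ℂ) - 1‖ ≤ ρ i := by
  induction j with
  | zero =>
      intro U W x _ _ _ _ _ _ ρ hρ0 _ i hi y μ
      obtain rfl : i = 0 := Nat.le_zero.mp hi
      exact hρ0 y μ
  | succ j ih =>
      intro U W x hUu hWu hx hs hUx hWx ρ hρ0 hρ i hi y μ
      rcases i with _ | i
      · exact hρ0 y μ
      · -- one step at the bottom pair, then the induction hypothesis at the averaged pair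
        obtain ⟨h512, hU₁u, hx₁, hU₁x⟩ := step_small hL hUu hx hs.1 hUx
        obtain ⟨-, hW₁u, -, hW₁x⟩ := step_small hL hWu hx hs.1 hWx
        have hone : ∀ (y' : Site d) (μ' : Fin d),
            ‖(((cavg L W y' μ')⁻¹ * cavg L U y' μ' : (Matrix n n ℂ)ˣ) : Matrix n n ℂ) - 1‖ ≤ ρ (0 + 1) := by
          intro y' μ'
          refine (norm_relLink_cavg_le hL hUu hWu hx hx h512 h512 hUx hWx hρ0 y' μ').trans ?_
          have h := hρ 0 (Nat.succ_pos _)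
          simp only [Function.iterate_zero, id] at h
          have e : (L : ℝ) * ρ 0 + 2 * L * ((nbRad d L : ℝ) * x) + 4 * (loopRad d L x + loopRad d L x)
              = (L : ℝ) * ρ 0 + (2 * L * (nbRad d L : ℝ) + 128 * ((d : ℝ) + 1) * ((d : ℝ) + 4) * (L : ℝ) ^ 2) * x := by
            unfold loopRad; ring
          rw [e]; exact h
        have hρ' : ∀ i', i' < j → (L : ℝ) * ρ (i' + 1)
            + (2 * L * (nbRad d L : ℝ) + 128 * ((d : ℝ) + 1) * ((d : ℝ) + 4) * (L : ℝ) ^ 2) * (prop1Radius d L)^[i'] (prop1Radius d L x)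
              ≤ ρ (i' + 1 + 1) := by
          intro i' hi'
          have h := hρ (i' + 1) (by omega)
          rw [Function.iterate_succ_apply] at h
          exact h
        have h := ih hU₁u hW₁u hx₁ hs.2 hU₁x hW₁x (ρ := fun i => ρ (i + 1)) hone hρ' i (by omega) y μ
        rw [cavgIter_succ, cavgIter_succ]
        exact h

/-! ## §3 The explicit majorant -/

/-- **THE EXPLICIT MAJORANT SATISFIES THE RECURSION** (`L ≥ 2`, `x ≥ 0`, `r₀ ≥ 0`): with `κ₁ = 2L·n_b + 128(d+1)(d+4)L²` and
`ρ_i = L^i·r₀ + (2κ₁∕L²)·x_i`, `L·ρ_i + κ₁·x_i ≤ ρ_{i+1}` — because `x_{i+1} ≥ L²·x_i` (`sq_mul_le_prop1Radius`) and `2(1 − 1∕L) ≥ 1`. [folklore] -/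
theorem majorant_step {L : ℕ} (hL : 2 ≤ L) {x : ℝ} (hx : 0 ≤ x) (r₀ : ℝ) (i : ℕ) :
    (L : ℝ) * ((L : ℝ) ^ i * r₀ + (2 * (2 * L * (nbRad d L : ℝ) + 128 * ((d : ℝ) + 1) * ((d : ℝ) + 4) * (L : ℝ) ^ 2) / (L : ℝ) ^ 2) * (prop1Radius d L)^[i] x)
        + (2 * L * (nbRad d L : ℝ) + 128 * ((d : ℝ) + 1) * ((d : ℝ) + 4) * (L : ℝ) ^ 2) * (prop1Radius d L)^[i] x
      ≤ (L : ℝ) ^ (i + 1) * r₀ + (2 * (2 * L * (nbRad d L : ℝ) + 128 * ((d : ℝ) + 1) * ((d : ℝ) + 4) * (L : ℝ) ^ 2) / (L : ℝ) ^ 2) * (prop1Radius d L)^[i + 1] x := by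
  have hL2 : (2 : ℝ) ≤ L := by exact_mod_cast hL
  have hL0 : (0 : ℝ) < L := by linarith
  set κ : ℝ := 2 * L * (nbRad d L : ℝ) + 128 * ((d : ℝ) + 1) * ((d : ℝ) + 4) * (L : ℝ) ^ 2 with hκ
  have hκ0 : 0 ≤ κ := by rw [hκ]; positivity
  set xi : ℝ := (prop1Radius d L)^[i] x with hxi
  have hxi0 : 0 ≤ xi := by rw [hxi]; exact iterate_prop1Radius_nonneg (d := d) i hx
  have hgrow : (L : ℝ) ^ 2 * xi ≤ (prop1Radius d L)^[i + 1] x := by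
    rw [Function.iterate_succ_apply', hxi]; exact sq_mul_le_prop1Radius (d := d) L _
  -- `L·(2κ∕L²)·xᵢ + κ·xᵢ = κ·xᵢ·(2∕L + 1) ≤ 2κ·xᵢ ≤ (2κ∕L²)·x_{i+1}`
  have h1 : (L : ℝ) * ((2 * κ / (L : ℝ) ^ 2) * xi) + κ * xi ≤ 2 * κ * xi := by
    have e : (L : ℝ) * ((2 * κ / (L : ℝ) ^ 2) * xi) = (2 / L) * (κ * xi) := by field_simp
    rw [e]
    have h2L : 2 / (L : ℝ) ≤ 1 := by rw [div_le_one hL0]; exact hL2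
    nlinarith [mul_nonneg hκ0 hxi0]
  have h2 : 2 * κ * xi ≤ (2 * κ / (L : ℝ) ^ 2) * (prop1Radius d L)^[i + 1] x := by
    have e : 2 * κ * xi = (2 * κ / (L : ℝ) ^ 2) * ((L : ℝ) ^ 2 * xi) := by field_simp
    rw [e]
    exact mul_le_mul_of_nonneg_left hgrow (by positivity)
  calc (L : ℝ) * ((L : ℝ) ^ i * r₀ + (2 * κ / (L : ℝ) ^ 2) * xi) + κ * xi
      = (L : ℝ) ^ (i + 1) * r₀ + ((L : ℝ) * ((2 * κ / (L : ℝ) ^ 2) * xi) + κ * xi) := by ring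
    _ ≤ (L : ℝ) ^ (i + 1) * r₀ + (2 * κ / (L : ℝ) ^ 2) * (prop1Radius d L)^[i + 1] x := by linarith [h1.trans h2]

/-- **THE RELATIVE LINK RADII ALONG THE TOWER, EXPLICIT** (`L ≥ 2`): in the `(j)`-level class at a common radius `x`, if `‖W⁻¹U − 1‖ ≤ r₀` everywhere, then for all
`i ≤ j` and all coarse bonds `‖(cavgIter L i W y μ)⁻¹·(cavgIter L i U y μ) − 1‖ ≤ L^i·r₀ + (2κ₁∕L²)·x_i`, `κ₁ = 2L·n_b + 128(d+1)(d+4)L²`. [folklore] -/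
theorem norm_relLink_cavgIter_le_explicit [Nonempty n] {L : ℕ} (hL : 2 ≤ L) (j : ℕ) {U W : Site d → Fin d → (Matrix n n ℂ)ˣ} {x : ℝ}
    (hUu : IsUnitaryCfg U) (hWu : IsUnitaryCfg W) (hx : 0 ≤ x) (hs : LevelSmall d L j x) (hUx : SmallField U x) (hWx : SmallField W x)
    {r₀ : ℝ} (hr₀ : ∀ (y : Site d) (μ : Fin d), ‖(((W y μ)⁻¹ * U y μ : (Matrix n n ℂ)ˣ) : Matrix n n ℂ) - 1‖ ≤ r₀)
    (i : ℕ) (hi : i ≤ j) (y : Site d) (μ : Fin d) :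
    ‖(((cavgIter L i W y μ)⁻¹ * cavgIter L i U y μ : (Matrix n n ℂ)ˣ) : Matrix n n ℂ) - 1‖
      ≤ (L : ℝ) ^ i * r₀ + (2 * (2 * L * (nbRad d L : ℝ) + 128 * ((d : ℝ) + 1) * ((d : ℝ) + 4) * (L : ℝ) ^ 2) / (L : ℝ) ^ 2) * (prop1Radius d L)^[i] x := by
  have hL1 : 1 ≤ L := by omega
  have hr00 : 0 ≤ r₀ := (norm_nonneg _).trans (hr₀ y μ)
  refine norm_relLink_cavgIter_le hL1 j hUu hWu hx hs hUx hWx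
    (ρ := fun i => (L : ℝ) ^ i * r₀ + (2 * (2 * L * (nbRad d L : ℝ) + 128 * ((d : ℝ) + 1) * ((d : ℝ) + 4) * (L : ℝ) ^ 2) / (L : ℝ) ^ 2) * (prop1Radius d L)^[i] x)
    (fun y' μ' => (hr₀ y' μ').trans ?_) (fun i _ => majorant_step (d := d) hL hx r₀ i) i hi y μ
  simp only [pow_zero, one_mul, Function.iterate_zero, id]
  have : 0 ≤ (2 * (2 * L * (nbRad d L : ℝ) + 128 * ((d : ℝ) + 1) * ((d : ℝ) + 4) * (L : ℝ) ^ 2) / (L : ℝ) ^ 2) * x := by positivity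
  linarith

end

end Summit.QuantumFields.BalabanUV.T4Continuum.NE7QbarCurvedBaseRadii
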